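import Literature.MathematicalPhysics.QuantumFieldTheory.BalabanImbrieJaffe1984to88.BIJ88Sect5StatementsPart4

/-!
# `BalabanImbrieJaffe1984to88.BIJ88F1Taylor290` — T. Bałaban, J. Imbrie, A. Jaffe, *Effective action and cluster properties
of the abelian Higgs model*, Commun. Math. Phys. **114** (1988) 257–315 [BalabanImbrieJaffe1988], §5.7 p. 290: the expansions
of `F_{1,j}` and `F_{2,j}` (of (5.6.7)–(5.6.8)) to order `n̄` in `e_j` with remainders — the two displays between (5.7.6) and
(5.7.7) — PROVED as the Taylor split of `F₁(w) = e^{w} − 1` with the exponential remainder bound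

statement-level skeleton of published theorems with citation tags; proofs where landed; nothing here is a claim about the Yang–Mills mass gap

PDF held: `paper:balaban1988-cmp114-bij-abelian-higgs-effective-action` (journal page = PDF page + 256).  Renders read this
session: p. 287 = PDF 31, p. 290 = PDF 34 (`pages/original-p031-x2.png`, `-p034-x2.png` of the p02 seat, read as images).

**What the paper prints (p. 290, verbatim).**  *"We may use (5.7.5) to analyze the interaction terms generated in the expansion
with respect to Ã̃ = θ_kH_{k,loc}A^{(k)} + w₅A′. Treating for the moment only the high order terms, we obtain an expansion for F_{1,j} in
(5.6.7): F_{1,j}(Ã̃^ζ_b) = Σ_{n=1}^{n̄} ζ^{−1}(ie_jζÃ̃^ζ_b)ⁿ/n! + Σ_X F_{1,j,b}(X), with |F_{1,j,b}(X)| ≦ e_j^{n̄+1−α}e^{−cr(e_k)|X|⁻}. (Here |X|⁻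
is defined as max{0, |X| − 1}, and Ã̃ has been rescaled to the ζ = L^{−j} lattice.) In a similar fashion we can write (F_{2,j}(Ã̃^ζ,
u_{k+1})φ)(y) = Σ_{x∈B_j(y)} ζ^du_{k+1}(Γ^{(j)}_{y,x})φ(x) × Σ_{n=1}^{n̄} (ie_jζÃ̃(Γ^{(j)}_{y,x}))ⁿ/n! + Σ_X (F_{2,j}(X)φ)(y), with
|F_{2,j}(X; y, x)| ≦ ζ^de_j^{n̄+1−α}e^{−cr(e_k)|X|⁻}."*  With (5.6.7) p. 287: *"ũ_{k+1}ũ = ũ_{k+1}(1 + Σ_{n=1}^∞ (ie_jζÃ)ⁿ/n!) =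
ũ_{k+1}(1 + F_{1,j}(Ã))"* (r16's `BIJ88Sect5Statements.F1 w = e^{w} − 1`) and (5.6.8) (r16's `BIJ88Sect5StatementsPart4.F2`).

**What is reproduced here (kernel-checked, zero `sorry`, no named facts).**
* DEFINITIONS (bodies = the printed sums): **`taylorF1 n̄ w`** `= Σ_{n=1}^{n̄} wⁿ/n!` (the order-`≤ n̄` part of `F₁(w) = e^{w} − 1`),
  **`remF1 n̄ w`** `= F₁(w) − taylorF1 n̄ w` (the *"high order terms"*), and the `F₂` analogues **`taylorF2`**, **`remF2`** (the sum of
  (5.6.8) with `F₁` replaced by its two parts).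
* `F1_split`, **`F1_zeta_split`** — the first display: `ζ^{−1}F₁(ie_jζÃ) = Σ_{n=1}^{n̄} ζ^{−1}(ie_jζÃ)ⁿ/n! + ζ^{−1}·remF1`; `F2_split` — the
  second display: `F₂ = taylorF2 + remF2` (r16's `F2` splits termwise).
* `remF1_eq_exp_sub` (`remF1 = e^{w} − Σ_{m=0}^{n̄} w^m/m!`), **`norm_remF1_le`** (`‖remF1 n̄ w‖ ≤ ‖w‖^{n̄+1}·(n̄+2)/((n̄+1)!(n̄+1))` for
  `‖w‖ ≤ 1`, Mathlib's `Complex.exp_bound`), **`norm_remF1_le_pow`** (`≤ ‖w‖^{n̄+1}` for `n̄ ≥ 1`), and the printed SHAPE of the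
  remainder bound **`norm_zeta_remF1_le`**: for `w = ie_jζÃ` with `e_jζ|Ã| ≤ 1`, `‖ζ^{−1}remF1‖ ≤ ζ^{n̄}e_j^{n̄+1}|Ã|^{n̄+1}`, hence
  `≤ e_j^{n̄+1−α}` as soon as `ζ^{n̄}|Ã|^{n̄+1} ≤ e_j^{−α}` (`norm_zeta_remF1_le_of`); `norm_remF2_term_le` — each term of `remF2` is
  bounded by `ζ^d·|φ(x)|·‖remF1‖` for unimodular transporters.

**Readings (declared).**  (i) the split is by ORDER in `e_j` of the exponential series of `F₁`; the further LOCALIZATION of both parts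
over regions `X` via (5.7.5) (`Σ_X F_{1,j,b}(X)`, the factor `e^{−cr(e_k)|X|⁻}`) is not modelled — the remainder here is the `X`-summed
high-order part; (ii) the smallness regime `‖w‖ = e_jζ|Ã̃| ≤ 1` (fields logarithmically bounded, `e_j` small); (iii) `n̄ ≥ 1` for the
clean power bound.

**What is NOT claimed.**  (5.7.5)–(5.7.6) (the localization of the powers of `w₅A′`; r16's `eq575`, `wbm`), (5.7.7)–(5.7.9) (`V_j`,
`W^{(j)}` and their bounds; r16's leaf `Ineq579`, p36's `BIJ88Ineq579Second`), the decay factor `e^{−cr(e_k)|X|⁻}`, the exponent `α`;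
anything of B1–B16.  NOT summit progress; NOT continuum; NOT Clay.  Imports: r16's `BIJ88Sect5StatementsPart4`; no Summits import;
sub-namespace `…BIJ88F1Taylor290`; modifies nothing.  Cell `lit-balaban` Phase 2, seat p02 gen 4; row C2.Eq5.7.7-5.7.9 (owner r16),
the p. 290 `F_{1,j}`/`F_{2,j}` expansion displays «absent» → typed + order-split/remainder bound proved.
-/

noncomputable section

open scoped BigOperators
open Complex

namespace Literature.MathematicalPhysics.QuantumFieldTheory.BalabanImbrieJaffe1984to88.BIJ88F1Taylor290

open BIJ88Sect5Statements (F1)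
open BIJ88Sect5StatementsPart4 (F2)

/-! ## The order-`n̄` split of `F₁(w) = e^{w} − 1` -/

/-- the order-`≤ n̄` part of `F₁`: `Σ_{n=1}^{n̄} wⁿ/n!` (p. 290, the first sum of the `F_{1,j}` display, with `w = ie_jζÃ̃^ζ_b`;
index written `n + 1`, `n < n̄`). [cite: BalabanImbrieJaffe1988, (5.7.7) p.290] -/
def taylorF1 (nbar : ℕ) (w : ℂ) : ℂ := ∑ n ∈ Finset.range nbar, w ^ (n + 1) / (n + 1).factorial

/-- the *"high order terms"* of `F₁`: `F₁(w) − Σ_{n=1}^{n̄} wⁿ/n!`. [cite: BalabanImbrieJaffe1988, (5.7.7) p.290] -/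
def remF1 (nbar : ℕ) (w : ℂ) : ℂ := F1 w - taylorF1 nbar w

/-- the split `F₁ = (order ≤ n̄) + (high order)`. [cite: BalabanImbrieJaffe1988, (5.7.7) p.290] -/
theorem F1_split (nbar : ℕ) (w : ℂ) : F1 w = taylorF1 nbar w + remF1 nbar w := by
  rw [remF1, add_sub_cancel]

/-- **p. 290, the `F_{1,j}` display**, verbatim: *"F_{1,j}(Ã̃^ζ_b) = Σ_{n=1}^{n̄} ζ^{−1}(ie_jζÃ̃^ζ_b)ⁿ/n! + Σ_X F_{1,j,b}(X)"* — the
`ζ^{−1}`-scaled split: `ζ^{−1}F₁(w) = Σ_{n=1}^{n̄} ζ^{−1}wⁿ/n! + ζ^{−1}·remF1` (the last term is what the print distributes over the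
regions `X`). [cite: BalabanImbrieJaffe1988, (5.7.7) p.290] -/
theorem F1_zeta_split (ζinv : ℂ) (nbar : ℕ) (w : ℂ) :
    ζinv * F1 w = (∑ n ∈ Finset.range nbar, ζinv * w ^ (n + 1) / (n + 1).factorial) + ζinv * remF1 nbar w := by
  rw [F1_split nbar w, mul_add, taylorF1, Finset.mul_sum]
  congr 1
  exact Finset.sum_congr rfl fun n _ => by ring

/-- the remainder is the tail of the exponential series: `remF1 n̄ w = e^{w} − Σ_{m=0}^{n̄} w^m/m!`.
[cite: BalabanImbrieJaffe1988, (5.7.7) p.290] -/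
theorem remF1_eq_exp_sub (nbar : ℕ) (w : ℂ) :
    remF1 nbar w = exp w - ∑ m ∈ Finset.range (nbar + 1), w ^ m / m.factorial := by
  rw [remF1, F1, taylorF1, Finset.sum_range_succ']
  simp
  ring

/-- **the remainder bound**: `‖remF1 n̄ w‖ ≤ ‖w‖^{n̄+1}·(n̄+2)/((n̄+1)!·(n̄+1))` for `‖w‖ ≤ 1` (Mathlib's `Complex.exp_bound`).
[cite: BalabanImbrieJaffe1988, (5.7.7) p.290] -/
theorem norm_remF1_le {w : ℂ} (hw : ‖w‖ ≤ 1) (nbar : ℕ) :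
    ‖remF1 nbar w‖ ≤ ‖w‖ ^ (nbar + 1) * (((nbar + 1).succ : ℝ) * ((nbar + 1).factorial * (nbar + 1 : ℕ) : ℝ)⁻¹) := by
  rw [remF1_eq_exp_sub]
  exact Complex.exp_bound hw (Nat.succ_pos nbar)

/-- … hence `‖remF1 n̄ w‖ ≤ ‖w‖^{n̄+1}` for `n̄ ≥ 1`, `‖w‖ ≤ 1` (the numerical factor is `≤ 3/4`).
[cite: BalabanImbrieJaffe1988, (5.7.7) p.290] -/
theorem norm_remF1_le_pow {w : ℂ} (hw : ‖w‖ ≤ 1) {nbar : ℕ} (hn : 1 ≤ nbar) : ‖remF1 nbar w‖ ≤ ‖w‖ ^ (nbar + 1) := by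
  have h := norm_remF1_le hw nbar
  have hfac : (((nbar + 1).succ : ℝ) * ((nbar + 1).factorial * (nbar + 1 : ℕ) : ℝ)⁻¹) ≤ 1 := by
    rw [mul_inv_le_iff₀ (by positivity), one_mul]
    have h2 : (2 : ℝ) ≤ ((nbar + 1).factorial : ℝ) := by
      have : 2 ≤ (nbar + 1).factorial := by
        calc 2 = (1 + 1).factorial := by decide
          _ ≤ (nbar + 1).factorial := Nat.factorial_le (by omega)
      exact_mod_cast this
    have h3 : ((nbar + 1).succ : ℝ) = (nbar : ℝ) + 2 := by push_cast; ring
    have h4 : (((nbar + 1 : ℕ) : ℕ) : ℝ) = (nbar : ℝ) + 1 := by push_cast; ring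
    rw [h3, h4]
    have hn' : (1 : ℝ) ≤ nbar := by exact_mod_cast hn
    nlinarith
  calc ‖remF1 nbar w‖ ≤ ‖w‖ ^ (nbar + 1) * _ := h
    _ ≤ ‖w‖ ^ (nbar + 1) * 1 := mul_le_mul_of_nonneg_left hfac (pow_nonneg (norm_nonneg _) _)
    _ = ‖w‖ ^ (nbar + 1) := mul_one _

/-- **the printed shape of the remainder bound** (*"|F_{1,j,b}(X)| ≦ e_j^{n̄+1−α}…"*): for `w = ie_jζÃ` with `e_j, ζ > 0`,
`e_jζ|Ã| ≤ 1`, `n̄ ≥ 1`: `‖ζ^{−1}·remF1‖ ≤ ζ^{n̄}e_j^{n̄+1}|Ã|^{n̄+1}`. [cite: BalabanImbrieJaffe1988, (5.7.7) p.290] -/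
theorem norm_zeta_remF1_le {ej ζ A : ℝ} (hej : 0 < ej) (hζ : 0 < ζ) (hsmall : ej * ζ * |A| ≤ 1) {nbar : ℕ} (hn : 1 ≤ nbar) :
    ‖(ζ : ℂ)⁻¹ * remF1 nbar (I * (ej * ζ * A : ℝ))‖ ≤ ζ ^ nbar * ej ^ (nbar + 1) * |A| ^ (nbar + 1) := by
  have hw : ‖(I * (ej * ζ * A : ℝ) : ℂ)‖ = ej * ζ * |A| := by
    rw [norm_mul, Complex.norm_I, one_mul, Complex.norm_real, Real.norm_eq_abs, abs_mul, abs_mul, abs_of_pos hej,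
      abs_of_pos hζ]
  have hrem := norm_remF1_le_pow (by rw [hw]; exact hsmall) hn
  rw [hw] at hrem
  rw [norm_mul, norm_inv, Complex.norm_real, Real.norm_eq_abs, abs_of_pos hζ]
  calc ζ⁻¹ * ‖remF1 nbar (I * (ej * ζ * A : ℝ))‖ ≤ ζ⁻¹ * (ej * ζ * |A|) ^ (nbar + 1) :=
        mul_le_mul_of_nonneg_left hrem (inv_nonneg.2 hζ.le)
    _ = ζ ^ nbar * ej ^ (nbar + 1) * |A| ^ (nbar + 1) := by
        rw [mul_pow, mul_pow, pow_succ ζ nbar]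
        field_simp

/-- … so `‖ζ^{−1}·remF1‖ ≤ e_j^{n̄+1−α}` whenever the field bound gives `ζ^{n̄}|Ã|^{n̄+1} ≤ e_j^{−α}` (logarithmically bounded
fields). [cite: BalabanImbrieJaffe1988, (5.7.7) p.290] -/
theorem norm_zeta_remF1_le_of {ej ζ A α : ℝ} (hej : 0 < ej) (hζ : 0 < ζ) (hsmall : ej * ζ * |A| ≤ 1) {nbar : ℕ} (hn : 1 ≤ nbar)
    (hfield : ζ ^ nbar * |A| ^ (nbar + 1) ≤ ej ^ (-α)) :
    ‖(ζ : ℂ)⁻¹ * remF1 nbar (I * (ej * ζ * A : ℝ))‖ ≤ ej ^ ((nbar : ℝ) + 1 - α) := by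
  have h := norm_zeta_remF1_le hej hζ hsmall hn
  have hrw : ej ^ ((nbar : ℝ) + 1 - α) = ej ^ (nbar + 1) * ej ^ (-α) := by
    rw [show (nbar : ℝ) + 1 - α = ((nbar + 1 : ℕ) : ℝ) + (-α) by push_cast; ring, Real.rpow_add hej, Real.rpow_natCast]
  rw [hrw]
  calc _ ≤ ζ ^ nbar * ej ^ (nbar + 1) * |A| ^ (nbar + 1) := h
    _ = ej ^ (nbar + 1) * (ζ ^ nbar * |A| ^ (nbar + 1)) := by ring
    _ ≤ ej ^ (nbar + 1) * ej ^ (-α) := mul_le_mul_of_nonneg_left hfield (pow_nonneg hej.le _)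

/-! ## The same split inside the covariant block average: `F_{2,j}` -/

/-- the order-`≤ n̄` part of `F₂` (p. 290, the `F_{2,j}` display): `Σ_{x∈B(y)} w·U(y,x)φ(x)·Σ_{n=1}^{n̄} a(y,x)ⁿ/n!` (r16's `F2` with
`F₁` replaced by `taylorF1`). [cite: BalabanImbrieJaffe1988, (5.7.7) p.290] -/
def taylorF2 {α β : Type*} (B : β → Finset α) (w : ℝ) (U : β → α → ℂ) (a : β → α → ℂ) (nbar : ℕ) (φ : α → ℂ) (y : β) : ℂ :=
  ∑ x ∈ B y, (w : ℂ) * U y x * φ x * taylorF1 nbar (a y x)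

/-- the high-order part of `F₂` (what the print distributes as `Σ_X (F_{2,j}(X)φ)(y)`). [cite: BalabanImbrieJaffe1988, (5.7.7) p.290] -/
def remF2 {α β : Type*} (B : β → Finset α) (w : ℝ) (U : β → α → ℂ) (a : β → α → ℂ) (nbar : ℕ) (φ : α → ℂ) (y : β) : ℂ :=
  ∑ x ∈ B y, (w : ℂ) * U y x * φ x * remF1 nbar (a y x)

/-- **p. 290, the `F_{2,j}` display**, verbatim: *"(F_{2,j}(Ã̃^ζ, u_{k+1})φ)(y) = Σ_{x∈B_j(y)} ζ^du_{k+1}(Γ^{(j)}_{y,x})φ(x) ×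
Σ_{n=1}^{n̄} (ie_jζÃ̃(Γ^{(j)}_{y,x}))ⁿ/n! + Σ_X (F_{2,j}(X)φ)(y)"* — PROVED for r16's `F2`: `F₂ = taylorF2 + remF2`.
[cite: BalabanImbrieJaffe1988, (5.7.7) p.290] -/
theorem F2_split {α β : Type*} (B : β → Finset α) (w : ℝ) (U a : β → α → ℂ) (nbar : ℕ) (φ : α → ℂ) (y : β) :
    F2 B w U a φ y = taylorF2 B w U a nbar φ y + remF2 B w U a nbar φ y := by
  simp only [F2, taylorF2, remF2, ← Finset.sum_add_distrib]
  exact Finset.sum_congr rfl fun x _ => by rw [F1_split nbar (a y x)]; ring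

/-- the printed shape *"|F_{2,j}(X; y, x)| ≦ ζ^d e_j^{n̄+1−α}…"*: each term of `remF2` is bounded by `w·|φ(x)|·‖remF1‖` for
unimodular transporters (`w = ζ^d`). [cite: BalabanImbrieJaffe1988, (5.7.7) p.290] -/
theorem norm_remF2_term_le {α β : Type*} {w : ℝ} (hw : 0 ≤ w) {U : β → α → ℂ} (hU : ∀ y x, ‖U y x‖ = 1) (a : β → α → ℂ)
    (nbar : ℕ) (φ : α → ℂ) (y : β) (x : α) :
    ‖(w : ℂ) * U y x * φ x * remF1 nbar (a y x)‖ ≤ w * ‖φ x‖ * ‖remF1 nbar (a y x)‖ := by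
  rw [norm_mul, norm_mul, norm_mul, hU, mul_one, Complex.norm_real, Real.norm_eq_abs, abs_of_nonneg hw]

end Literature.MathematicalPhysics.QuantumFieldTheory.BalabanImbrieJaffe1984to88.BIJ88F1Taylor290

end
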